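import Literature.NumberTheory.EllipticCurves.FineSelmerIsotypicClassGroupCriterionLayer
import HarnessLib

/-!
# DOOR L5 for elliptic curves over `ℚ`: Conjecture A from the `S`-split `E[p]`-part of the class group
# of ONE layer `ℚ(E[p])ℚ_{n+1}` of the cyclotomic tower — no condition `E(ℚ_p)[p] = 0` (PROVED)

Topic `NumberTheory/EllipticCurves` (grouping namespace `CoatesSujatha2005`).  THEOREM-ONLY file (no
definition, no named fact, no `sorry`), written by the literature seat `bsd-potss-conjA-anchor` g18 (cell
`bsd-potss`; serves the asides stmt-BirchSwinnertonDyer-19386 / 19413; closes nothing; Conjecture A / BSD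
is proved for NO particular curve here — the per-row inputs (c1), (c2)_{S,n+1}, (c3′)/(c3) stay
hypotheses to be certified by the record lanes).

`E/ℚ` elliptic (`W`), `p` an odd prime, `κ` the cyclotomic `ℤ_p`-extension of `ℚ` with layers `ℚ_m`,
`L_m = ℚ(E[p])ℚ_m = W.divisionField p ⊔ κ.layer m`.  Fix `n`.  A finite set `bad` of places of `ℚ`
(rational primes `q ≠ p`, typically the primes of bad reduction) is admissible at the layer `n + 1` when
every `q ∈ bad` satisfies EITHER
  (c3′) some `σ` of the decomposition group `D_q ≤ Γ_ℚ` fixes `ℚ(E[p])` and has `κ(σ) ∉ p^{n+1}ℤ_p`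
        (⟺ the prime of `ℚ(E[p])` under the chosen prime above `q` does NOT split completely in
        `L_{n+1}/ℚ(E[p])`; for `q` unramified in `ℚ(E[p])` this is «`q` not completely split in
        `ℚ_{n+1}`», i.e. `q^{p-1} ≢ 1 (mod p^{n+2})` — the seat's (c3′)_{n+1} of g15, memo §2.2–2.4),
  OR (c3) `E[p]^{D_q} = 0` (`E(ℚ_q)[p] = 0`).

* `finite_fineSelmerInfty_torsion_of_homTrivial_layer` — (c1) `p ∤ #Gal(ℚ(E[p])/ℚ)` and (c2)_{S,n+1}:
  every additive `Γ_ℚ`-equivariant `Cl(𝓞_{L_{n+1}}) → E[p]` killing the classes of the primes of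
  `L_{n+1}` above `p` and above `bad` is zero ⟹ `Sel₀(ℚ_∞, E[p])` is finite.
* **`conjA_of_homTrivial_layer`** — … ⟹ statement (A): the Pontryagin dual of `Sel₀(ℚ_∞, E[p^∞])` is
  finitely generated over `ℤ_p` (`∃ γ D, Module.Finite ℤ_[p] D.X`), by Lim–Sujatha's lemma.
* `conjA_of_homTrivial_layer_above_p` — the case `bad = ∅`: only the classes above `p` are quotiented.

WHY IT MATTERS (cell `bsd-potss`, items 19386 / 19413 / 19942 / 19916): Deo–Ray–Sujatha's Thm. 3.8/3.9
and the tree's door L6 need (c3) AT `p` (`E(ℚ_p)[p] = 0`); on the ♯ rows of the census this fails and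
their criterion is void at every layer.  Door L5 replaces (c3) at `p` by NOTHING (at the layers `≥ 1`
the primes above `p` are swallowed by total ramification) and (c3) at a bad `q` by (c3′).  The seat's
g15 computations found (c2)_{S,1} on 59 K9/KT rows at `p = 3` (among them six residue rows of 19942 and
130095bp1 of 19916); each becomes a kernel road to (A) modulo its single displayed class-group datum
once instantiated by a record lane (no `μ`, no Ferrero–Washington, no Iwasawa growth formula, no anchor).
The road is NOT the printed one (DRS/Ray–Sujatha go through `H²(ℚ_S/ℚ_n, E[p])`, Poitou–Tate); it is the
`H²`-free descent of this series (`FineSelmerIsotypicClassGroupCriterionLayer`).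

## References

* J. Coates, R. Sujatha, Math. Ann. 331 (2005), §3 Thm. 3.4, Lemma 3.8. [CoatesSujatha2005]
* S. V. Deo, A. Ray, R. Sujatha, Pure Appl. Math. Q. 19 (2023), §3 Thm. 3.8, 3.9 (arXiv:2202.09937
  pp. 9–10). [DeoRaySujatha2023]
* A. Ray, R. Sujatha, arXiv:2508.17156 (2025), Cor. 3.7. [RaySujatha2025]
* M. F. Lim, R. Sujatha, J. Number Theory 187 (2018), §3 (lemma before Prop. 3.2). [LimSujatha2018]
-/

noncomputable section

open scoped Classical Pointwise nonZeroDivisors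
open NumberField Field IntermediateField IsDedekindDomain WeierstrassCurve
open Literature.NumberTheory.GaloisRepresentations Literature.NumberTheory.NumberFields
open Literature.NumberTheory.EllipticCurves Literature.NumberTheory.EllipticCurves.GreenbergSelmer

namespace Literature.NumberTheory.EllipticCurves.CoatesSujatha2005

section Rat

variable {p : ℕ} [Fact p.Prime]

omit [Fact p.Prime] in
/-- The only place of `ℚ` containing the prime `p`. [folklore] -/
private theorem heightOneSpectrum_rat_eq_of_natCast_memR (hp : p.Prime) (v v' : HeightOneSpectrum (𝓞 ℚ))
    (hv : ((p : ℕ) : 𝓞 ℚ) ∈ v.asIdeal) (hv' : ((p : ℕ) : 𝓞 ℚ) ∈ v'.asIdeal) : v = v' := by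
  have key : ∀ w : HeightOneSpectrum (𝓞 ℚ), ((p : ℕ) : 𝓞 ℚ) ∈ w.asIdeal →
      Rat.HeightOneSpectrum.primesEquiv w = ⟨p, hp⟩ := by
    intro w hw
    apply Subtype.ext
    change Rat.HeightOneSpectrum.natGenerator w = p
    have h1 : Rat.HeightOneSpectrum.natGenerator w ∣ p := by
      rw [Rat.HeightOneSpectrum.natGenerator_dvd_iff,
        ← map_natCast (Rat.IsIntegralClosure.intEquiv (𝓞 ℚ)) p]
      exact Ideal.mem_map_of_mem _ hw
    exact (Nat.prime_dvd_prime_iff_eq (Rat.HeightOneSpectrum.prime_natGenerator w) hp).mp h1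
  exact Rat.HeightOneSpectrum.primesEquiv.injective ((key v hv).trans (key v' hv').symm)

omit [Fact p.Prime] in
/-- `E[p]` is killed by `p`. [folklore] -/
private theorem geomTorsion_nsmul_eq_zeroR (W : WeierstrassCurve ℚ) [W.IsElliptic]
    (v : geomTorsion W (p : ℤ)) : p • v = 0 := by
  apply Subtype.ext
  have hv : ((v : geomTorsion W (p : ℤ)) : geomPoints W) ∈
      AddSubgroup.torsionBy (geomPoints W) (p : ℤ) := v.2
  rw [AddSubgroup.torsionBy, Submodule.mem_toAddSubgroup, Submodule.mem_torsionBy_iff] at hv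
  rw [AddSubgroupClass.coe_nsmul, ZeroMemClass.coe_zero, ← natCast_zsmul]
  exact hv

omit [Fact p.Prime] in
/-- `p ∤ #Gal(L/k) ⟹ p ∤ [L : k]`. [folklore] -/
private theorem not_dvd_finrank_of_not_dvd_cardR {k : Type} [Field k]
    (L : IntermediateField k (AlgebraicClosure k)) [FiniteDimensional k L] [IsGalois k L]
    (h : ¬ p ∣ Nat.card (L ≃ₐ[k] L)) : ¬ p ∣ Module.finrank k L := by
  rwa [← IsGalois.card_aut_eq_finrank k L]

set_option maxHeartbeats 800000 in
set_option synthInstance.maxHeartbeats 200000 in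
/-- **Door L5 ⟹ `Sel₀(ℚ_∞, E[p])` finite.**  `E/ℚ` (`W`), `p` odd, `κ` cyclotomic,
`L_{n+1} = ℚ(E[p])ℚ_{n+1} = W.divisionField p ⊔ κ.layer (n + 1)`; (c1) `p ∤ #Gal(ℚ(E[p])/ℚ)`; `bad` a
set of finite places of `ℚ`, each with (c3′) «some `σ ∈ D_q` fixing `ℚ(E[p])` has `κ(σ) ∉ p^{n+1}ℤ_p`»
or (c3) «`E[p]^{D_q} = 0`»; (c2)_{S,n+1}: every additive `Γ_ℚ`-equivariant `Cl(𝓞_{L_{n+1}}) → E[p]`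
killing the classes of the primes above `p` and above `bad` is zero.  Then the fine Selmer group of
`E[p]` over `ℚ_∞` is finite.  (`finite_fineSelmerInfty_of_equivariantHom_classGroup_layer_eq_zero` at
`K = ℚ`: `p` lies in one place of `ℚ`, totally ramified in `ℚ_∞`.)  NO hypothesis at `p` beyond (c1).
[cite: CoatesSujatha2005, §3 Thm. 3.4 (proof) and Lemma 3.8]
[cite: DeoRaySujatha2023, §3 Thm. 3.8 (c1), (c2), definition of H′_L (arXiv:2202.09937 p. 9)] -/
theorem finite_fineSelmerInfty_torsion_of_homTrivial_layer
    (W : WeierstrassCurve ℚ) [W.IsElliptic] (hp2 : p ≠ 2)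
    (hG : ¬ p ∣ Nat.card ((W.divisionField p) ≃ₐ[ℚ] (W.divisionField p)))
    {κ : ZpExtension ℚ p} (hκ : κ.IsCyclotomic) (n : ℕ)
    (bad : HeightOneSpectrum (𝓞 ℚ) → Prop)
    (hbad : ∀ u : HeightOneSpectrum (𝓞 ℚ), bad u →
      (∃ σ ∈ GreenbergSelmer.decomp u, absRestrictNormalHom (W.divisionField p) σ = 1 ∧
          ¬ (p : ℤ_[p]) ^ (n + 1) ∣ (κ σ).toAdd) ∨
      (∀ x : geomTorsion W (p : ℤ), (∀ d ∈ GreenbergSelmer.decomp u, d • x = x) → x = 0))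
    (hL5 : haveI := κ.isGalois_layer_holds (n + 1)
      haveI := κ.finiteDimensional_layer_holds (n + 1)
      haveI : NumberField ↥(W.divisionField p ⊔ κ.layer (n + 1)) := NumberField.of_module_finite ℚ _
      ∀ (f : Additive (ClassGroup (𝓞 ↥(W.divisionField p ⊔ κ.layer (n + 1)))) →+
        geomTorsion W (p : ℤ)),
      (∀ (τ : absoluteGaloisGroup ℚ) (c : ClassGroup (𝓞 ↥(W.divisionField p ⊔ κ.layer (n + 1)))),
        f (Additive.ofMul (ClassGroup.mulEquiv (AmbiguousClass.intAut
          (absRestrictNormalHom (W.divisionField p ⊔ κ.layer (n + 1)) τ)) c)) =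
          τ • f (Additive.ofMul c)) →
      (∀ (w : HeightOneSpectrum (𝓞 ↥(W.divisionField p ⊔ κ.layer (n + 1))))
          (u : HeightOneSpectrum (𝓞 ℚ)), (((p : ℕ) : 𝓞 ℚ) ∈ u.asIdeal ∨ bad u) →
        w.asIdeal.under (𝓞 ℚ) = u.asIdeal →
        f (Additive.ofMul (ClassGroup.mk0 ⟨w.asIdeal, mem_nonZeroDivisors_of_ne_zero w.ne_bot⟩)) = 0) →
      f = 0) :
    (fineSelmerInfty (↥(W.geomTorsion (p : ℤ))) κ :
      Set (subgroupH1 κ.kerSubgroup (W.geomTorsion (p : ℤ)))).Finite := by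
  have hp : p.Prime := Fact.out
  haveI hgal := fun m => κ.isGalois_layer_holds m
  haveI hfd := fun m => κ.finiteDimensional_layer_holds m
  haveI hNF : ∀ m, NumberField ↥(W.divisionField p ⊔ κ.layer m) :=
    fun m => NumberField.of_module_finite ℚ _
  haveI : Finite (geomTorsion W (p : ℤ)) :=
    finite_torsionPoints_holds W (AlgebraicClosure ℚ) (by exact_mod_cast hp.ne_zero)
  -- the totally ramified prime and the place of `p`
  obtain ⟨𝔓', h𝔓'max, hsup⟩ :=
    EquivariantIwasawaLemma.exists_isMaximal_inertia_sup_kerSubgroup_eq_top_of_isCyclotomic hκ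
  haveI := h𝔓'max
  obtain ⟨v₀, hv₀𝔓⟩ : ∃ v₀ : HeightOneSpectrum (𝓞 ℚ), 𝔓' ∈ v₀.primesAbove := by
    haveI : (𝔓'.under (𝓞 ℚ)).IsMaximal := Ideal.IsMaximal.under (𝓞 ℚ) 𝔓'
    have hne : 𝔓'.under (𝓞 ℚ) ≠ ⊥ := Ring.ne_bot_of_isMaximal_of_not_isField inferInstance
      (RingOfIntegers.not_isField ℚ)
    exact ⟨⟨𝔓'.under (𝓞 ℚ), Ideal.IsMaximal.isPrime inferInstance, hne⟩,
      HeightOneSpectrum.mem_primesAbove_iff.mpr ⟨h𝔓'max.isPrime, ⟨rfl⟩⟩⟩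
  have hv₀ : ((p : ℕ) : 𝓞 ℚ) ∈ v₀.asIdeal := by
    by_contra h
    have hle := ZpExtension.inertia_le_kerSubgroup_holds ℚ p κ h hv₀𝔓
    have htop : κ.kerSubgroup = ⊤ := by
      rw [eq_top_iff, ← hsup]
      exact sup_le hle le_rfl
    obtain ⟨γ, hγ⟩ := κ.surjective (Multiplicative.ofAdd 1)
    rw [ZpExtension.coe_toContinuousMonoidHom] at hγ
    have h1 : κ γ = 1 := ZpExtension.mem_kerSubgroup.mp (htop ▸ Subgroup.mem_top γ)
    rw [hγ] at h1
    have h2 : (1 : ℤ_[p]) = 0 := Multiplicative.ofAdd.injective h1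
    exact one_ne_zero h2
  exact finite_fineSelmerInfty_of_equivariantHom_classGroup_layer_eq_zero hp2 κ (W.divisionField p)
    (not_dvd_finrank_of_not_dvd_cardR (W.divisionField p) hG)
    (geomTorsion_nsmul_eq_zeroR W)
    (fun τ hτ v => (W.absRestrictNormalHom_divisionField_eq_one_iff p τ).mp hτ v) v₀ hv₀
    (fun v hv => heightOneSpectrum_rat_eq_of_natCast_memR hp v v₀ hv hv₀) hv₀𝔓 hsup n bad hbad hL5

/-- **DOOR L5 ⟹ CONJECTURE A.**  `E/ℚ` elliptic (`W`), `p` an odd prime, `κ` the cyclotomic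
`ℤ_p`-extension of `ℚ`, `L_{n+1} = ℚ(E[p])ℚ_{n+1}`.  Assume (c1) `p ∤ #Gal(ℚ(E[p])/ℚ)`; a set `bad` of
finite places of `ℚ` each satisfying (c3′) (a decomposition element above `q` fixing `ℚ(E[p])` with
`κ`-value outside `p^{n+1}ℤ_p` — `q` not completely split in `L_{n+1}/ℚ(E[p])`) or (c3) (`E[p]^{D_q} = 0`);
and (c2)_{S,n+1}: every additive `Γ_ℚ`-equivariant `Cl(𝓞_{L_{n+1}}) → E[p]` killing the classes of the
primes of `L_{n+1}` above `p` and above `bad` is zero (the `E[p]`-isotypic part of the `S`-split class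
group of ONE layer vanishes).  Then statement (A) holds for `E` at `p`: the dual fine Selmer group over
`ℚ_∞` is finitely generated over `ℤ_p`.  NOTHING is assumed at `p` beyond (c1) — in particular not
`E(ℚ_p)[p] = 0`: this is the ♯-tolerant criterion («door L5») that Deo–Ray–Sujatha's Thm. 3.8/3.9 and the
layer-`0` door L6 cannot provide.  Proof: `finite_fineSelmerInfty_torsion_of_homTrivial_layer` and
Lim–Sujatha's lemma `LimSujatha2018.fineSelmerDual_moduleFinite_iff_finite_fineSelmerInfty_torsion`.
[cite: CoatesSujatha2005, §3 Thm. 3.4 and Lemma 3.8]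
[cite: DeoRaySujatha2023, §3 Thm. 3.8 hypotheses (c1), (c2) and the definition of H′_L (arXiv:2202.09937 p. 9)]
[cite: LimSujatha2018, §3 (the lemma before Prop. 3.2)] -/
theorem conjA_of_homTrivial_layer
    (W : WeierstrassCurve ℚ) [W.IsElliptic] (hp2 : p ≠ 2)
    (hG : ¬ p ∣ Nat.card ((W.divisionField p) ≃ₐ[ℚ] (W.divisionField p)))
    {κ : ZpExtension ℚ p} (hκ : κ.IsCyclotomic) (n : ℕ)
    (bad : HeightOneSpectrum (𝓞 ℚ) → Prop)
    (hbad : ∀ u : HeightOneSpectrum (𝓞 ℚ), bad u →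
      (∃ σ ∈ GreenbergSelmer.decomp u, absRestrictNormalHom (W.divisionField p) σ = 1 ∧
          ¬ (p : ℤ_[p]) ^ (n + 1) ∣ (κ σ).toAdd) ∨
      (∀ x : geomTorsion W (p : ℤ), (∀ d ∈ GreenbergSelmer.decomp u, d • x = x) → x = 0))
    (hL5 : haveI := κ.isGalois_layer_holds (n + 1)
      haveI := κ.finiteDimensional_layer_holds (n + 1)
      haveI : NumberField ↥(W.divisionField p ⊔ κ.layer (n + 1)) := NumberField.of_module_finite ℚ _
      ∀ (f : Additive (ClassGroup (𝓞 ↥(W.divisionField p ⊔ κ.layer (n + 1)))) →+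
        geomTorsion W (p : ℤ)),
      (∀ (τ : absoluteGaloisGroup ℚ) (c : ClassGroup (𝓞 ↥(W.divisionField p ⊔ κ.layer (n + 1)))),
        f (Additive.ofMul (ClassGroup.mulEquiv (AmbiguousClass.intAut
          (absRestrictNormalHom (W.divisionField p ⊔ κ.layer (n + 1)) τ)) c)) =
          τ • f (Additive.ofMul c)) →
      (∀ (w : HeightOneSpectrum (𝓞 ↥(W.divisionField p ⊔ κ.layer (n + 1))))
          (u : HeightOneSpectrum (𝓞 ℚ)), (((p : ℕ) : 𝓞 ℚ) ∈ u.asIdeal ∨ bad u) →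
        w.asIdeal.under (𝓞 ℚ) = u.asIdeal →
        f (Additive.ofMul (ClassGroup.mk0 ⟨w.asIdeal, mem_nonZeroDivisors_of_ne_zero w.ne_bot⟩)) = 0) →
      f = 0) :
    ∃ (γ : absoluteGaloisGroup ℚ) (D : W.FineSelmerDualData κ γ),
      Module.Finite ℤ_[p] (RestrictScalars ℤ_[p] (IwasawaAlgebra p) D.X) :=
  (LimSujatha2018.fineSelmerDual_moduleFinite_iff_finite_fineSelmerInfty_torsion W hp2 κ hκ).mpr
    (finite_fineSelmerInfty_torsion_of_homTrivial_layer W hp2 hG hκ n bad hbad hL5)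

/-- **Door L5, the simplest shape (`bad = ∅`): (A) from the vanishing of every `Γ_ℚ`-equivariant
additive `Cl(𝓞_{ℚ(E[p])ℚ_{n+1}}) → E[p]` killing the classes of the primes above `p`**, under (c1) only.
[cite: CoatesSujatha2005, §3 Thm. 3.4 and Lemma 3.8]
[cite: DeoRaySujatha2023, §3 Thm. 3.8 (c1), (c2) (arXiv:2202.09937 p. 9)] -/
theorem conjA_of_homTrivial_layer_above_p
    (W : WeierstrassCurve ℚ) [W.IsElliptic] (hp2 : p ≠ 2)
    (hG : ¬ p ∣ Nat.card ((W.divisionField p) ≃ₐ[ℚ] (W.divisionField p)))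
    {κ : ZpExtension ℚ p} (hκ : κ.IsCyclotomic) (n : ℕ)
    (hL5 : haveI := κ.isGalois_layer_holds (n + 1)
      haveI := κ.finiteDimensional_layer_holds (n + 1)
      haveI : NumberField ↥(W.divisionField p ⊔ κ.layer (n + 1)) := NumberField.of_module_finite ℚ _
      ∀ (f : Additive (ClassGroup (𝓞 ↥(W.divisionField p ⊔ κ.layer (n + 1)))) →+
        geomTorsion W (p : ℤ)),
      (∀ (τ : absoluteGaloisGroup ℚ) (c : ClassGroup (𝓞 ↥(W.divisionField p ⊔ κ.layer (n + 1)))),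
        f (Additive.ofMul (ClassGroup.mulEquiv (AmbiguousClass.intAut
          (absRestrictNormalHom (W.divisionField p ⊔ κ.layer (n + 1)) τ)) c)) =
          τ • f (Additive.ofMul c)) →
      (∀ (w : HeightOneSpectrum (𝓞 ↥(W.divisionField p ⊔ κ.layer (n + 1))))
          (u : HeightOneSpectrum (𝓞 ℚ)), ((p : ℕ) : 𝓞 ℚ) ∈ u.asIdeal →
        w.asIdeal.under (𝓞 ℚ) = u.asIdeal →
        f (Additive.ofMul (ClassGroup.mk0 ⟨w.asIdeal, mem_nonZeroDivisors_of_ne_zero w.ne_bot⟩)) = 0) →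
      f = 0) :
    ∃ (γ : absoluteGaloisGroup ℚ) (D : W.FineSelmerDualData κ γ),
      Module.Finite ℤ_[p] (RestrictScalars ℤ_[p] (IwasawaAlgebra p) D.X) := by
  refine conjA_of_homTrivial_layer W hp2 hG hκ n (fun _ => False) (fun u hu => hu.elim) ?_
  intro f hf hfS
  refine hL5 f hf fun w u hu hwu => hfS w u (Or.inl hu) hwu

/-- **(c3′) from «`q` does not split completely in `K_{n+1}`»** (no reference to `L₀ = ℚ(E[p])`;
stated over a number field `K`, used at `K = ℚ`): if
`p ∤ #Gal(L₀/K)` and the subgroup `D ≤ Γ_K` is NOT contained in `Gal(K̄/K_{n+1})`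
(`κ.layerSubgroup (n + 1) = κ⁻¹(p^{n+1}ℤ_p)`), then some `σ ∈ D` fixes `L₀` and has
`κ(σ) ∉ p^{n+1}ℤ_p`: take `σ = σ₀^{#Gal(L₀/ℚ)}` for any `σ₀ ∈ D` outside `Gal(ℚ̄/ℚ_{n+1})`
(`#Gal(L₀/ℚ)` is a unit of `ℤ_p`).  For `D = D_q`, `q ≠ p`: «`q` not completely split in `ℚ_{n+1}`»,
i.e. `q^{p-1} ≢ 1 (mod p^{n+2})` (g15 memo §2.3–2.4 of the seat).  A lemma (decomposition groups and
the layers of a `ℤ_p`-extension); the cites record the printed setting it transcribes.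
[cite: Washington1997, §13.1 Prop. 13.2 and Lemma 13.3 (layers `K_n`, decomposition in `K_∞/K`)]
[cite: NeukirchANT1999, Ch. I §9 Prop. (9.3) (complete splitting ⟺ trivial decomposition group)] -/
theorem exists_mem_of_not_le_layerSubgroup {K : Type} [Field K] [NumberField K]
    (L₀ : IntermediateField K (AlgebraicClosure K)) [FiniteDimensional K L₀] [IsGalois K L₀]
    (hG : ¬ p ∣ Nat.card (L₀ ≃ₐ[K] L₀)) (κ : ZpExtension K p) (n : ℕ)
    (D : Subgroup (absoluteGaloisGroup K)) (hD : ¬ (D ≤ κ.layerSubgroup (n + 1))) :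
    ∃ σ ∈ D, absRestrictNormalHom L₀ σ = 1 ∧ ¬ (p : ℤ_[p]) ^ (n + 1) ∣ (κ σ).toAdd := by
  have hp : p.Prime := Fact.out
  obtain ⟨σ₀, hσ₀D, hσ₀⟩ := Set.not_subset.mp hD
  rw [SetLike.mem_coe, ZpExtension.mem_layerSubgroup] at hσ₀
  set N : ℕ := Nat.card (L₀ ≃ₐ[K] L₀) with hN
  refine ⟨σ₀ ^ N, D.pow_mem hσ₀D N, ?_, ?_⟩
  · rw [map_pow]
    exact orderOf_dvd_iff_pow_eq_one.mp (orderOf_dvd_natCard _)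
  · have hunit : IsUnit (N : ℤ_[p]) := by
      rw [PadicInt.isUnit_iff, PadicInt.norm_natCast_eq_one_iff]
      exact (Nat.Prime.coprime_iff_not_dvd hp).mpr hG
    intro h
    apply hσ₀
    have e : (κ (σ₀ ^ N)).toAdd = (N : ℤ_[p]) * (κ σ₀).toAdd := by
      rw [map_pow, toAdd_pow, nsmul_eq_mul]
    rw [e] at h
    exact (hunit.dvd_mul_left).mp h

/-- **DOOR L5 ⟹ CONJECTURE A, with (c3′) in the form «`q` not completely split in `ℚ_{n+1}`»**: as
`conjA_of_homTrivial_layer`, the bad places of type (c3′) being given by `¬ (D_q ≤ Gal(ℚ̄/ℚ_{n+1}))`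
(the chosen decomposition group at `q` acts non-trivially on the layer `κ.layer (n + 1)`; for
`q ≠ p` this is `q^{p-1} ≢ 1 (mod p^{n+2})`), converted by `exists_mem_of_not_le_layerSubgroup` (which
uses (c1)).
[cite: CoatesSujatha2005, §3 Thm. 3.4 and Lemma 3.8]
[cite: DeoRaySujatha2023, §3 Thm. 3.8 hypotheses (c1), (c2) and the definition of H′_L (arXiv:2202.09937 p. 9)]
[cite: LimSujatha2018, §3 (the lemma before Prop. 3.2)] -/
theorem conjA_of_homTrivial_layer'
    (W : WeierstrassCurve ℚ) [W.IsElliptic] (hp2 : p ≠ 2)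
    (hG : ¬ p ∣ Nat.card ((W.divisionField p) ≃ₐ[ℚ] (W.divisionField p)))
    {κ : ZpExtension ℚ p} (hκ : κ.IsCyclotomic) (n : ℕ)
    (bad : HeightOneSpectrum (𝓞 ℚ) → Prop)
    (hbad : ∀ u : HeightOneSpectrum (𝓞 ℚ), bad u →
      ¬ (GreenbergSelmer.decomp u ≤ κ.layerSubgroup (n + 1)) ∨
      (∀ x : geomTorsion W (p : ℤ), (∀ d ∈ GreenbergSelmer.decomp u, d • x = x) → x = 0))
    (hL5 : haveI := κ.isGalois_layer_holds (n + 1)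
      haveI := κ.finiteDimensional_layer_holds (n + 1)
      haveI : NumberField ↥(W.divisionField p ⊔ κ.layer (n + 1)) := NumberField.of_module_finite ℚ _
      ∀ (f : Additive (ClassGroup (𝓞 ↥(W.divisionField p ⊔ κ.layer (n + 1)))) →+
        geomTorsion W (p : ℤ)),
      (∀ (τ : absoluteGaloisGroup ℚ) (c : ClassGroup (𝓞 ↥(W.divisionField p ⊔ κ.layer (n + 1)))),
        f (Additive.ofMul (ClassGroup.mulEquiv (AmbiguousClass.intAut
          (absRestrictNormalHom (W.divisionField p ⊔ κ.layer (n + 1)) τ)) c)) =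
          τ • f (Additive.ofMul c)) →
      (∀ (w : HeightOneSpectrum (𝓞 ↥(W.divisionField p ⊔ κ.layer (n + 1))))
          (u : HeightOneSpectrum (𝓞 ℚ)), (((p : ℕ) : 𝓞 ℚ) ∈ u.asIdeal ∨ bad u) →
        w.asIdeal.under (𝓞 ℚ) = u.asIdeal →
        f (Additive.ofMul (ClassGroup.mk0 ⟨w.asIdeal, mem_nonZeroDivisors_of_ne_zero w.ne_bot⟩)) = 0) →
      f = 0) :
    ∃ (γ : absoluteGaloisGroup ℚ) (D : W.FineSelmerDualData κ γ),
      Module.Finite ℤ_[p] (RestrictScalars ℤ_[p] (IwasawaAlgebra p) D.X) := by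
  refine conjA_of_homTrivial_layer W hp2 hG hκ n bad (fun u hu => ?_) hL5
  rcases hbad u hu with h | h
  · exact Or.inl (exists_mem_of_not_le_layerSubgroup (W.divisionField p) hG κ n _ h)
  · exact Or.inr h

end Rat

end Literature.NumberTheory.EllipticCurves.CoatesSujatha2005

end
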